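import Summits.KontsevichZagierPeriods.KontsevichZagierPeriods.Theorems.ValuedFieldSpecialisationCTConstructionElementarySliceValue
import Summits.KontsevichZagierPeriods.KontsevichZagierPeriods.Theorems.ValuedFieldSpecialisationCTConstructionDivergentMonomialsFilter
import Summits.KontsevichZagierPeriods.KontsevichZagierPeriods.Theorems.ValuedFieldSpecialisationCTConstructionConstantTermOfNormalForm
import Literature.NumberTheory.Transcendental.KZDominatedFamilyRelations
import Literature.NumberTheory.Transcendental.PeriodConjecture

/-!
# Route ValuedFieldSpecialisation — crux `CTConstruction`: the composition of line `registered`, and what it yields now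

Helper toward crux stmt-KontsevichZagierPeriods-3495 (`CTConstruction`: an additive constant-term map
`CT : KZ.FormalRep →+ KZ.FormalRep` with (CT1) values = constant terms of slice expansions, (CT2) fibred move
generators ↦ `KZ.relations`, (CT3) dominated families ↦ their special fibres). Line `registered`
(`Cruxes/CTConstruction/Lines/birth.lean`) builds `CT` as `FreeAbelianGroup.lift` of "generator ↦ special-fibre
class of a CHOSEN fibred normal form". Of its five registered stubs three are landed (the whole VALUE level:
`stub_elementarySliceValue`, `stub_divergentMonomialsFilter`, `stub_constantTermOfNormalForm'`); the two open ones
are the existence of normal forms (verbatim the route item `ClassLevelExpansion`, stmt-3496) and the class-level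
core `stub_specialFibreRigidityOfEval` (special fibres of a fibred relation among normal forms form a relation,
given that their value vanishes).

This file lands the line's sorry-free COMPOSITION for an arbitrary target subgroup `H ≤ KZ.FormalRep`
(`ctConstruction_of_normalForms_to`) and its two consequences available today:

* `stub_ctConstruction_modKer_of_classLevelExpansion` (registered sub-goal of the crux) — UNCONDITIONALLY IN THE CALCULUS: `ClassLevelExpansion` alone
  already gives the value-level constant-term functor, i.e. `CTConstruction` with `KZ.relations` replaced by
  `ker KZ.eval` in (CT2)/(CT3) (the pivot the route header foresees: "CT into FormalRep/ker eval"); rigidity into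
  `ker eval` is the landed value shadow (`stub_constantTermOfNormalForm'` at `x = 0`).
* `ctConstruction_of_classLevelExpansion_of_kzKernelConjecture` — `ClassLevelExpansion → KZKernelConjecture →
  CTConstruction`: the crux is implied by the route's existence item together with the Kontsevich–Zagier kernel
  conjecture (equivalently the summit, `kzKernelConjecture_iff_isRational`), so it cannot be refuted without
  refuting one of them, and the ONLY missing ingredient of the line beyond item 3496 is the class-level rigidity.

Sources: M. Kontsevich, D. Zagier, *Periods* (2001), §1.2; route ValuedFieldSpecialisation (the objects). No new
definitions. Deliberately NOT here: any claim toward `ClassLevelExpansion` or toward the class-level rigidity.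
-/

noncomputable section

namespace Summit.KontsevichZagierPeriods.ValuedFieldSpecialisation

open Summit.KontsevichZagierPeriods.KontsevichZagierPeriods.Theses.ValuedFieldSpecialisation (CTConstruction ClassLevelExpansion)

open Literature.NumberTheory.Transcendental

/-- **The composition of line `registered`, arrow form, for an arbitrary target subgroup `H`**: EXISTENCE of
fibred normal forms (route item `ClassLevelExpansion`, verbatim) → RIGIDITY of special fibres INTO `H` (a fibred
relation `D + G` among normal forms has special-fibre class `y ∈ H`) → VALUE of the constant term (birth stub 3,
verbatim; landed) → the three clauses of `CTConstruction` with `KZ.relations` replaced by `H` in (CT2), (CT3).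
`CT := FreeAbelianGroup.lift` of "generator ↦ special-fibre class of a CHOSEN normal form" (dimension-`0`
generators ↦ `0`); pure algebra in the free abelian group. With `H = KZ.relations` the conclusion is the crux
unfolded; with `H = KZ.eval.ker` it is its value-level shadow. [folklore] -/
theorem ctConstruction_of_normalForms_to (H : AddSubgroup Literature.NumberTheory.Transcendental.KZ.FormalRep) :
    (∀ (n : ℕ) (R : Literature.NumberTheory.Transcendental.KZ.IntegralRep (n + 1)), ∃ (D G : Literature.NumberTheory.Transcendental.KZ.FormalRep), (∃ (k : ℕ) (m : Fin k → ℤ) (p q b d : Fin k → ℕ) (r : (i : Fin k) → Literature.NumberTheory.Transcendental.KZ.IntegralRep (d i)) (P : (i : Fin k) → Literature.NumberTheory.Transcendental.KZ.IntegralRep (b i + d i + 1 + 1)), (∀ i, 0 < q i ∧ (0 < p i ∨ 0 < b i) ∧ (P i).domain = {z | ∃ (s u : ℝ) (y : Fin (b i) → ℝ) (w : Fin (d i) → ℝ), z = Matrix.vecCons s (Matrix.vecCons u (Fin.append y w)) ∧ 0 < s ∧ s < 1 ∧ 0 < u ∧ u ^ (q i) * s ^ (p i) < 1 ∧ (∀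 j, s ≤ y j ∧ y j ≤ 1) ∧ w ∈ (r i).domain} ∧ (P i).integrand = fun z => (∏ j : Fin (b i), (z (Fin.castAdd (d i) j).succ.succ)⁻¹) * (r i).integrand (fun l : Fin (d i) => z (Fin.natAdd (b i) l).succ.succ)) ∧ D = ∑ i, m i • Literature.NumberTheory.Transcendental.KZ.of (P i)) ∧ (∃ (k : ℕ) (d : Fin k → ℕ) (m : Fin k → ℤ) (S : (i : Fin k) → Literature.NumberTheory.Transcendental.KZ.IntegralRep (d i + 1)) (r₀ g : (i : Fin k) → Literature.NumberTheory.Transcendental.KZ.IntegralRep (d i)), (∀ i, ((∃ ε > (0 : ℝ), ∀ z ∈ (S i).domain, 0 < z 0 → z 0 < ε → (fun i : Fin (d i) => z i.succ) ∈ (g i).domain ∧ |(S i).integrand z| ≤ (g i).integrand (fun i : Fin (d i) => z i.succ)) ∧ (∀ᵐ x : Fin (d i) → ℝ, ∀ᶠ s in nhdsWithin (0 : ℝ) (Set.Ioi 0), (Matrix.vecCons s x ∈ (S i).domain ↔ x ∈ (r₀ i).domain)) ∧ (∀ᵐ x : Fin (d i) → ℝ, x ∈ (r₀ i).domain → Filter.Tendsto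 (fun s : ℝ => (S i).integrand (Matrix.vecCons s x)) (nhdsWithin 0 (Set.Ioi 0)) (nhds ((r₀ i).integrand x))))) ∧ G = ∑ i, m i • Literature.NumberTheory.Transcendental.KZ.of (S i)) ∧ Literature.NumberTheory.Transcendental.KZ.of R - D - G ∈ AddSubgroup.closure (Literature.NumberTheory.Transcendental.KZ.domainAddRel ∪ Literature.NumberTheory.Transcendental.KZ.integrandAddRel ∪ {c | ∃ (n : ℕ) (r r' : Literature.NumberTheory.Transcendental.KZ.IntegralRep (n + 1)) (Φ : (Fin (n + 1) → ℝ) → (Fin (n + 1) → ℝ)) (Φ' : (Fin (n + 1) → ℝ) → (Fin (n + 1) → ℝ) →L[ℝ] (Fin (n + 1) → ℝ)), Literature.NumberTheory.Transcendental.IsSemialgebraicMapOn ℚ r.domain Φ ∧ (∀ x ∈ r.domain, HasFDerivWithinAt Φ (Φ' x) r.domain x) ∧ Set.InjOn Φ r.domain ∧ r'.domain = Φ '' r.domain ∧ (∀ x ∈ r.domain, r.integrand x = r'.integrand (Φ x) * |(Φ' x).det|) ∧ (∀ x ∈ r.domain, Φ x 0 = x 0) ∧ c = Literature.NumberTheory.Transcendental.KZ.of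 r - Literature.NumberTheory.Transcendental.KZ.of r'} ∪ {c | c ∈ Literature.NumberTheory.Transcendental.KZ.newtonLeibnizRel ∧ ∃ (n : ℕ) (r : Literature.NumberTheory.Transcendental.KZ.IntegralRep (n + 2)) (r' : Literature.NumberTheory.Transcendental.KZ.IntegralRep (n + 1)), c = Literature.NumberTheory.Transcendental.KZ.of r - Literature.NumberTheory.Transcendental.KZ.of r'})) →
    (∀ D ∈ AddSubgroup.closure {x : Literature.NumberTheory.Transcendental.KZ.FormalRep | ∃ (p q b d : ℕ) (r : Literature.NumberTheory.Transcendental.KZ.IntegralRep d) (P : Literature.NumberTheory.Transcendental.KZ.IntegralRep (b + d + 1 + 1)), 0 < q ∧ (0 < p ∨ 0 < b) ∧ P.domain = {z | ∃ (s u : ℝ) (y : Fin b → ℝ) (w : Fin d → ℝ), z = Matrix.vecCons s (Matrix.vecCons u (Fin.append y w)) ∧ 0 < s ∧ s < 1 ∧ 0 < u ∧ u ^ q * s ^ p < 1 ∧ (∀ j, s ≤ y j ∧ y j ≤ 1) ∧ w ∈ r.domain} ∧ P.integrand = (fun z => (∏ j : Fin b, (z (Fin.castAdd d j).succ.succ)⁻¹)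 * r.integrand (fun l : Fin d => z (Fin.natAdd b l).succ.succ)) ∧ x = Literature.NumberTheory.Transcendental.KZ.of P}, ∀ (G y : Literature.NumberTheory.Transcendental.KZ.FormalRep), (G, y) ∈ AddSubgroup.closure {v : Literature.NumberTheory.Transcendental.KZ.FormalRep × Literature.NumberTheory.Transcendental.KZ.FormalRep | ∃ (n : ℕ) (S : Literature.NumberTheory.Transcendental.KZ.IntegralRep (n + 1)) (r₀ g : Literature.NumberTheory.Transcendental.KZ.IntegralRep n), ((∃ ε > (0 : ℝ), ∀ z ∈ S.domain, 0 < z 0 → z 0 < ε → (fun i : Fin n => z i.succ) ∈ g.domain ∧ |S.integrand z| ≤ g.integrand (fun i : Fin n => z i.succ)) ∧ (∀ᵐ x : Fin n → ℝ, ∀ᶠ s in nhdsWithin (0 : ℝ) (Set.Ioi 0), (Matrix.vecCons s x ∈ S.domain ↔ x ∈ r₀.domain)) ∧ (∀ᵐ x : Fin n → ℝ, x ∈ r₀.domain → Filter.Tendsto (fun s : ℝ => S.integrand (Matrix.vecCons s x)) (nhdsWithin 0 (Set.Ioi 0)) (nhds (r₀.integrand x)))) ∧ v = (Literature.NumberTheory.Transcendental.KZ.of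 S, Literature.NumberTheory.Transcendental.KZ.of r₀)} → D + G ∈ AddSubgroup.closure (Literature.NumberTheory.Transcendental.KZ.domainAddRel ∪ Literature.NumberTheory.Transcendental.KZ.integrandAddRel ∪ {c | ∃ (n : ℕ) (r r' : Literature.NumberTheory.Transcendental.KZ.IntegralRep (n + 1)) (Φ : (Fin (n + 1) → ℝ) → (Fin (n + 1) → ℝ)) (Φ' : (Fin (n + 1) → ℝ) → (Fin (n + 1) → ℝ) →L[ℝ] (Fin (n + 1) → ℝ)), Literature.NumberTheory.Transcendental.IsSemialgebraicMapOn ℚ r.domain Φ ∧ (∀ x ∈ r.domain, HasFDerivWithinAt Φ (Φ' x) r.domain x) ∧ Set.InjOn Φ r.domain ∧ r'.domain = Φ '' r.domain ∧ (∀ x ∈ r.domain, r.integrand x = r'.integrand (Φ x) * |(Φ' x).det|) ∧ (∀ x ∈ r.domain, Φ x 0 = x 0) ∧ c = Literature.NumberTheory.Transcendental.KZ.of r - Literature.NumberTheory.Transcendental.KZ.of r'} ∪ {c | c ∈ Literature.NumberTheory.Transcendental.KZ.newtonLeibnizRel ∧ ∃ (n : ℕ) (r : Literature.NumberTheory.Transcendental.KZ.IntegralRep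 (n + 2)) (r' : Literature.NumberTheory.Transcendental.KZ.IntegralRep (n + 1)), c = Literature.NumberTheory.Transcendental.KZ.of r - Literature.NumberTheory.Transcendental.KZ.of r'}) → y ∈ H) →
    (∀ (n : ℕ) (R : Literature.NumberTheory.Transcendental.KZ.IntegralRep (n + 1)) (c : ℝ), (∃ (k : ℕ) (a : Fin k → ℚ) (b : Fin k → ℕ) (w : Fin k → ℝ), (∀ i, a i < 0 ∨ (a i = 0 ∧ 0 < b i)) ∧ Filter.Tendsto (fun s : ℝ => (∫ x in {x : Fin n → ℝ | Matrix.vecCons s x ∈ R.domain}, R.integrand (Matrix.vecCons s x)) - ∑ i, w i * s ^ ((a i : ℚ) : ℝ) * Real.log s ^ (b i)) (nhdsWithin 0 (Set.Ioi 0)) (nhds c)) → ∀ D ∈ AddSubgroup.closure {x : Literature.NumberTheory.Transcendental.KZ.FormalRep | ∃ (p q b d : ℕ) (r : Literature.NumberTheory.Transcendental.KZ.IntegralRep d) (P : Literature.NumberTheory.Transcendental.KZ.IntegralRep (b + d + 1 + 1)), 0 < q ∧ (0 < p ∨ 0 < b) ∧ P.domain = {z | ∃ (s u : ℝ) (y :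 Fin b → ℝ) (w : Fin d → ℝ), z = Matrix.vecCons s (Matrix.vecCons u (Fin.append y w)) ∧ 0 < s ∧ s < 1 ∧ 0 < u ∧ u ^ q * s ^ p < 1 ∧ (∀ j, s ≤ y j ∧ y j ≤ 1) ∧ w ∈ r.domain} ∧ P.integrand = (fun z => (∏ j : Fin b, (z (Fin.castAdd d j).succ.succ)⁻¹) * r.integrand (fun l : Fin d => z (Fin.natAdd b l).succ.succ)) ∧ x = Literature.NumberTheory.Transcendental.KZ.of P}, ∀ (G y : Literature.NumberTheory.Transcendental.KZ.FormalRep), (G, y) ∈ AddSubgroup.closure {v : Literature.NumberTheory.Transcendental.KZ.FormalRep × Literature.NumberTheory.Transcendental.KZ.FormalRep | ∃ (n : ℕ) (S : Literature.NumberTheory.Transcendental.KZ.IntegralRep (n + 1)) (r₀ g : Literature.NumberTheory.Transcendental.KZ.IntegralRep n), ((∃ ε > (0 : ℝ), ∀ z ∈ S.domain, 0 < z 0 → z 0 < ε → (fun i : Fin n => z i.succ) ∈ g.domain ∧ |S.integrand z| ≤ g.integrand (fun i : Fin n => z i.succ)) ∧ (∀ᵐ x : Fin n → ℝ, ∀ᶠ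 s in nhdsWithin (0 : ℝ) (Set.Ioi 0), (Matrix.vecCons s x ∈ S.domain ↔ x ∈ r₀.domain)) ∧ (∀ᵐ x : Fin n → ℝ, x ∈ r₀.domain → Filter.Tendsto (fun s : ℝ => S.integrand (Matrix.vecCons s x)) (nhdsWithin 0 (Set.Ioi 0)) (nhds (r₀.integrand x)))) ∧ v = (Literature.NumberTheory.Transcendental.KZ.of S, Literature.NumberTheory.Transcendental.KZ.of r₀)} → Literature.NumberTheory.Transcendental.KZ.of R - D - G ∈ AddSubgroup.closure (Literature.NumberTheory.Transcendental.KZ.domainAddRel ∪ Literature.NumberTheory.Transcendental.KZ.integrandAddRel ∪ {c | ∃ (n : ℕ) (r r' : Literature.NumberTheory.Transcendental.KZ.IntegralRep (n + 1)) (Φ : (Fin (n + 1) → ℝ) → (Fin (n + 1) → ℝ)) (Φ' : (Fin (n + 1) → ℝ) → (Fin (n + 1) → ℝ) →L[ℝ] (Fin (n + 1) → ℝ)), Literature.NumberTheory.Transcendental.IsSemialgebraicMapOn ℚ r.domain Φ ∧ (∀ x ∈ r.domain, HasFDerivWithinAt Φ (Φ' x) r.domain x) ∧ Set.InjOn Φ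 r.domain ∧ r'.domain = Φ '' r.domain ∧ (∀ x ∈ r.domain, r.integrand x = r'.integrand (Φ x) * |(Φ' x).det|) ∧ (∀ x ∈ r.domain, Φ x 0 = x 0) ∧ c = Literature.NumberTheory.Transcendental.KZ.of r - Literature.NumberTheory.Transcendental.KZ.of r'} ∪ {c | c ∈ Literature.NumberTheory.Transcendental.KZ.newtonLeibnizRel ∧ ∃ (n : ℕ) (r : Literature.NumberTheory.Transcendental.KZ.IntegralRep (n + 2)) (r' : Literature.NumberTheory.Transcendental.KZ.IntegralRep (n + 1)), c = Literature.NumberTheory.Transcendental.KZ.of r - Literature.NumberTheory.Transcendental.KZ.of r'}) → Literature.NumberTheory.Transcendental.KZ.eval y = c) →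
    (∃ CT : Literature.NumberTheory.Transcendental.KZ.FormalRep →+ Literature.NumberTheory.Transcendental.KZ.FormalRep, (∀ (n : ℕ) (R : Literature.NumberTheory.Transcendental.KZ.IntegralRep (n + 1)) (c : ℝ), (∃ (k : ℕ) (a : Fin k → ℚ) (b : Fin k → ℕ) (w : Fin k → ℝ), (∀ i, a i < 0 ∨ (a i = 0 ∧ 0 < b i)) ∧ Filter.Tendsto (fun s : ℝ => (∫ x in {x : Fin n → ℝ | Matrix.vecCons s x ∈ R.domain}, R.integrand (Matrix.vecCons s x)) - ∑ i, w i * s ^ ((a i : ℚ) : ℝ) * Real.log s ^ (b i)) (nhdsWithin 0 (Set.Ioi 0)) (nhds c)) → Literature.NumberTheory.Transcendental.KZ.eval (CT (Literature.NumberTheory.Transcendental.KZ.of R)) = c) ∧ (∀ c ∈ (Literature.NumberTheory.Transcendental.KZ.domainAddRel ∪ Literature.NumberTheory.Transcendental.KZ.integrandAddRel ∪ {c | ∃ (n : ℕ) (r r' : Literature.NumberTheory.Transcendental.KZ.IntegralRep (n + 1)) (Φ : (Fin (n + 1) → ℝ) → (Fin (n + 1) → ℝ)) (Φ' : (Fin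 (n + 1) → ℝ) → (Fin (n + 1) → ℝ) →L[ℝ] (Fin (n + 1) → ℝ)), Literature.NumberTheory.Transcendental.IsSemialgebraicMapOn ℚ r.domain Φ ∧ (∀ x ∈ r.domain, HasFDerivWithinAt Φ (Φ' x) r.domain x) ∧ Set.InjOn Φ r.domain ∧ r'.domain = Φ '' r.domain ∧ (∀ x ∈ r.domain, r.integrand x = r'.integrand (Φ x) * |(Φ' x).det|) ∧ (∀ x ∈ r.domain, Φ x 0 = x 0) ∧ c = Literature.NumberTheory.Transcendental.KZ.of r - Literature.NumberTheory.Transcendental.KZ.of r'} ∪ {c | c ∈ Literature.NumberTheory.Transcendental.KZ.newtonLeibnizRel ∧ ∃ (n : ℕ) (r : Literature.NumberTheory.Transcendental.KZ.IntegralRep (n + 2)) (r' : Literature.NumberTheory.Transcendental.KZ.IntegralRep (n + 1)), c = Literature.NumberTheory.Transcendental.KZ.of r - Literature.NumberTheory.Transcendental.KZ.of r'}), CT c ∈ H) ∧ (∀ (n : ℕ) (R : Literature.NumberTheory.Transcendental.KZ.IntegralRep (n + 1)) (r₀ g : Literature.NumberTheory.Transcendental.KZ.IntegralRep n), ((∃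 ε > (0 : ℝ), ∀ z ∈ R.domain, 0 < z 0 → z 0 < ε → (fun i : Fin n => z i.succ) ∈ g.domain ∧ |R.integrand z| ≤ g.integrand (fun i : Fin n => z i.succ)) ∧ (∀ᵐ x : Fin n → ℝ, ∀ᶠ s in nhdsWithin (0 : ℝ) (Set.Ioi 0), (Matrix.vecCons s x ∈ R.domain ↔ x ∈ r₀.domain)) ∧ (∀ᵐ x : Fin n → ℝ, x ∈ r₀.domain → Filter.Tendsto (fun s : ℝ => R.integrand (Matrix.vecCons s x)) (nhdsWithin 0 (Set.Ioi 0)) (nhds (r₀.integrand x)))) → CT (Literature.NumberTheory.Transcendental.KZ.of R) - Literature.NumberTheory.Transcendental.KZ.of r₀ ∈ H)) := by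
  intro hE hR hV
  classical
  -- Step 0: normal forms in subgroup form (elementary part in the closure of the elementary classes, dominated
  -- part paired with its special-fibre combination in the closure of the dominated pairs).
  have hNF : ∀ (n : ℕ) (R : KZ.IntegralRep (n + 1)), ∃ (D G y : KZ.FormalRep),
      D ∈ AddSubgroup.closure {x : Literature.NumberTheory.Transcendental.KZ.FormalRep | ∃ (p q b d : ℕ) (r : Literature.NumberTheory.Transcendental.KZ.IntegralRep d) (P : Literature.NumberTheory.Transcendental.KZ.IntegralRep (b + d + 1 + 1)), 0 < q ∧ (0 < p ∨ 0 < b) ∧ P.domain = {z | ∃ (s u : ℝ) (y : Fin b → ℝ) (w : Fin d → ℝ), z = Matrix.vecCons s (Matrix.vecCons u (Fin.append y w)) ∧ 0 < s ∧ s < 1 ∧ 0 < u ∧ u ^ q * s ^ p < 1 ∧ (∀ j, s ≤ y j ∧ y j ≤ 1) ∧ w ∈ r.domain} ∧ P.integrand = (fun z => (∏ j : Fin b, (z (Fin.castAdd d j).succ.succ)⁻¹) * r.integrand (fun l : Fin d => z (Fin.natAdd b l).succ.succ)) ∧ x = Literature.NumberTheory.Transcendental.KZ.of P} ∧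
      (G, y) ∈ AddSubgroup.closure {v : Literature.NumberTheory.Transcendental.KZ.FormalRep × Literature.NumberTheory.Transcendental.KZ.FormalRep | ∃ (n : ℕ) (S : Literature.NumberTheory.Transcendental.KZ.IntegralRep (n + 1)) (r₀ g : Literature.NumberTheory.Transcendental.KZ.IntegralRep n), ((∃ ε > (0 : ℝ), ∀ z ∈ S.domain, 0 < z 0 → z 0 < ε → (fun i : Fin n => z i.succ) ∈ g.domain ∧ |S.integrand z| ≤ g.integrand (fun i : Fin n => z i.succ)) ∧ (∀ᵐ x : Fin n → ℝ, ∀ᶠ s in nhdsWithin (0 : ℝ) (Set.Ioi 0), (Matrix.vecCons s x ∈ S.domain ↔ x ∈ r₀.domain)) ∧ (∀ᵐ x : Fin n → ℝ, x ∈ r₀.domain → Filter.Tendsto (fun s : ℝ => S.integrand (Matrix.vecCons s x)) (nhdsWithin 0 (Set.Ioi 0)) (nhds (r₀.integrand x)))) ∧ v = (Literature.NumberTheory.Transcendental.KZ.of S, Literature.NumberTheory.Transcendental.KZ.of r₀)} ∧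
      KZ.of R - D - G ∈ AddSubgroup.closure (Literature.NumberTheory.Transcendental.KZ.domainAddRel ∪ Literature.NumberTheory.Transcendental.KZ.integrandAddRel ∪ {c | ∃ (n : ℕ) (r r' : Literature.NumberTheory.Transcendental.KZ.IntegralRep (n + 1)) (Φ : (Fin (n + 1) → ℝ) → (Fin (n + 1) → ℝ)) (Φ' : (Fin (n + 1) → ℝ) → (Fin (n + 1) → ℝ) →L[ℝ] (Fin (n + 1) → ℝ)), Literature.NumberTheory.Transcendental.IsSemialgebraicMapOn ℚ r.domain Φ ∧ (∀ x ∈ r.domain, HasFDerivWithinAt Φ (Φ' x) r.domain x) ∧ Set.InjOn Φ r.domain ∧ r'.domain = Φ '' r.domain ∧ (∀ x ∈ r.domain, r.integrand x = r'.integrand (Φ x) * |(Φ' x).det|) ∧ (∀ x ∈ r.domain, Φ x 0 = x 0) ∧ c = Literature.NumberTheory.Transcendental.KZ.of r - Literature.NumberTheory.Transcendental.KZ.of r'} ∪ {c | c ∈ Literature.NumberTheory.Transcendental.KZ.newtonLeibnizRel ∧ ∃ (n : ℕ) (r : Literature.NumberTheory.Transcendental.KZ.IntegralRep (n + 2)) (r'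 : Literature.NumberTheory.Transcendental.KZ.IntegralRep (n + 1)), c = Literature.NumberTheory.Transcendental.KZ.of r - Literature.NumberTheory.Transcendental.KZ.of r'}) := by
    intro n R
    obtain ⟨D, G, ⟨k, m, p, q, b, d, r, P, hP, hD⟩, ⟨k', d', m', S, r₀, g, hS, hG⟩, hmem⟩ := hE n R
    refine ⟨D, G, ∑ i, m' i • KZ.of (r₀ i), ?_, ?_, hmem⟩
    · -- each elementary divergent product family is a generator of the elementary subgroup
      have hPmem : ∀ i, KZ.of (P i) ∈ {x : Literature.NumberTheory.Transcendental.KZ.FormalRep | ∃ (p q b d : ℕ) (r : Literature.NumberTheory.Transcendental.KZ.IntegralRep d) (P : Literature.NumberTheory.Transcendental.KZ.IntegralRep (b + d + 1 + 1)), 0 < q ∧ (0 < p ∨ 0 < b) ∧ P.domain = {z | ∃ (s u : ℝ) (y : Fin b → ℝ) (w : Fin d → ℝ), z = Matrix.vecCons s (Matrix.vecCons u (Fin.append y w)) ∧ 0 < s ∧ s < 1 ∧ 0 < u ∧ u ^ q * s ^ p < 1 ∧ (∀ j, s ≤ y j ∧ y j ≤ 1) ∧ w ∈ r.domain} ∧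 P.integrand = (fun z => (∏ j : Fin b, (z (Fin.castAdd d j).succ.succ)⁻¹) * r.integrand (fun l : Fin d => z (Fin.natAdd b l).succ.succ)) ∧ x = Literature.NumberTheory.Transcendental.KZ.of P} := fun i =>
        ⟨p i, q i, b i, d i, r i, P i, (hP i).1, (hP i).2.1, (hP i).2.2.1, (hP i).2.2.2, rfl⟩
      rw [hD]
      exact sum_mem fun i _ => zsmul_mem (AddSubgroup.subset_closure (hPmem i)) _
    · -- each dominated family, paired with its special fibre, is a generator of the pair subgroup
      have hSmem : ∀ i, (KZ.of (S i), KZ.of (r₀ i)) ∈ {v : Literature.NumberTheory.Transcendental.KZ.FormalRep × Literature.NumberTheory.Transcendental.KZ.FormalRep | ∃ (n : ℕ) (S : Literature.NumberTheory.Transcendental.KZ.IntegralRep (n + 1)) (r₀ g : Literature.NumberTheory.Transcendental.KZ.IntegralRep n), ((∃ ε > (0 : ℝ), ∀ z ∈ S.domain, 0 < z 0 → z 0 < ε → (fun i : Fin n => z i.succ) ∈ g.domain ∧ |S.integrand z| ≤ g.integrand (fun i : Fin n => z i.succ)) ∧ (∀ᵐ x : Fin n → ℝ, ∀ᶠ s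 in nhdsWithin (0 : ℝ) (Set.Ioi 0), (Matrix.vecCons s x ∈ S.domain ↔ x ∈ r₀.domain)) ∧ (∀ᵐ x : Fin n → ℝ, x ∈ r₀.domain → Filter.Tendsto (fun s : ℝ => S.integrand (Matrix.vecCons s x)) (nhdsWithin 0 (Set.Ioi 0)) (nhds (r₀.integrand x)))) ∧ v = (Literature.NumberTheory.Transcendental.KZ.of S, Literature.NumberTheory.Transcendental.KZ.of r₀)} := fun i =>
        ⟨d' i, S i, r₀ i, g i, hS i, rfl⟩
      have hY : (∑ i, m' i • (KZ.of (S i), KZ.of (r₀ i))) ∈ AddSubgroup.closure {v : Literature.NumberTheory.Transcendental.KZ.FormalRep × Literature.NumberTheory.Transcendental.KZ.FormalRep | ∃ (n : ℕ) (S : Literature.NumberTheory.Transcendental.KZ.IntegralRep (n + 1)) (r₀ g : Literature.NumberTheory.Transcendental.KZ.IntegralRep n), ((∃ ε > (0 : ℝ), ∀ z ∈ S.domain, 0 < z 0 → z 0 < ε → (fun i : Fin n => z i.succ) ∈ g.domain ∧ |S.integrand z| ≤ g.integrand (fun i : Fin n => z i.succ)) ∧ (∀ᵐ x : Fin n → ℝ,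 ∀ᶠ s in nhdsWithin (0 : ℝ) (Set.Ioi 0), (Matrix.vecCons s x ∈ S.domain ↔ x ∈ r₀.domain)) ∧ (∀ᵐ x : Fin n → ℝ, x ∈ r₀.domain → Filter.Tendsto (fun s : ℝ => S.integrand (Matrix.vecCons s x)) (nhdsWithin 0 (Set.Ioi 0)) (nhds (r₀.integrand x)))) ∧ v = (Literature.NumberTheory.Transcendental.KZ.of S, Literature.NumberTheory.Transcendental.KZ.of r₀)} :=
        sum_mem fun i _ => zsmul_mem (AddSubgroup.subset_closure (hSmem i)) _
      have hEq : (∑ i, m' i • (KZ.of (S i), KZ.of (r₀ i))) =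
          (∑ i, m' i • KZ.of (S i), ∑ i, m' i • KZ.of (r₀ i)) := by
        ext <;> simp [Prod.fst_sum, Prod.snd_sum]
      rw [hG, ← hEq]
      exact hY
  choose D G y hD hGy hF using hNF
  -- the generator map: positive-dimensional generators to the special-fibre class of the chosen normal
  -- form, dimension-0 generators (no family structure) to 0
  let g : (Σ n, KZ.IntegralRep n) → KZ.FormalRep := fun x => match x with
    | ⟨0, _⟩ => 0
    | ⟨n + 1, R⟩ => y n R
  have lift_ctGen_of_succ : ∀ (n : ℕ) (R : KZ.IntegralRep (n + 1)),
      FreeAbelianGroup.lift g (KZ.of R) = y n R := fun n R => by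
    show FreeAbelianGroup.lift g (FreeAbelianGroup.of ⟨n + 1, R⟩) = y n R
    rw [FreeAbelianGroup.lift_apply_of]
  have lift_ctGen_of_zero : ∀ R : KZ.IntegralRep 0, FreeAbelianGroup.lift g (KZ.of R) = 0 := fun R => by
    show FreeAbelianGroup.lift g (FreeAbelianGroup.of ⟨0, R⟩) = 0
    rw [FreeAbelianGroup.lift_apply_of]
  refine ⟨FreeAbelianGroup.lift g, ?_, ?_, ?_⟩
  · -- (CT1) the value of the constant-term class is the constant term
    intro n R c hc
    rw [lift_ctGen_of_succ]
    exact hV n R c hc (D n R) (hD n R) (G n R) (y n R) (hGy n R) (hF n R)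
  · -- (CT2) fibred move generators go to relations
    intro c hc
    have hcF : c ∈ AddSubgroup.closure (Literature.NumberTheory.Transcendental.KZ.domainAddRel ∪ Literature.NumberTheory.Transcendental.KZ.integrandAddRel ∪ {c | ∃ (n : ℕ) (r r' : Literature.NumberTheory.Transcendental.KZ.IntegralRep (n + 1)) (Φ : (Fin (n + 1) → ℝ) → (Fin (n + 1) → ℝ)) (Φ' : (Fin (n + 1) → ℝ) → (Fin (n + 1) → ℝ) →L[ℝ] (Fin (n + 1) → ℝ)), Literature.NumberTheory.Transcendental.IsSemialgebraicMapOn ℚ r.domain Φ ∧ (∀ x ∈ r.domain, HasFDerivWithinAt Φ (Φ' x) r.domain x) ∧ Set.InjOn Φ r.domain ∧ r'.domain = Φ '' r.domain ∧ (∀ x ∈ r.domain, r.integrand x = r'.integrand (Φ x) * |(Φ' x).det|) ∧ (∀ x ∈ r.domain, Φ x 0 = x 0) ∧ c = Literature.NumberTheory.Transcendental.KZ.of r - Literature.NumberTheory.Transcendental.KZ.of r'} ∪ {c | c ∈ Literature.NumberTheory.Transcendental.KZ.newtonLeibnizRel ∧ ∃ (n : ℕ) (r : Literature.NumberTheory.Transcendental.KZ.IntegralRep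 (n + 2)) (r' : Literature.NumberTheory.Transcendental.KZ.IntegralRep (n + 1)), c = Literature.NumberTheory.Transcendental.KZ.of r - Literature.NumberTheory.Transcendental.KZ.of r'}) := AddSubgroup.subset_closure hc
    rcases hc with ((hc | hc) | hc) | hc
    · -- (1a) additivity in the domain
      obtain ⟨m, r, r₁, r₂, -, -, -, -, rfl⟩ := hc
      cases m with
      | zero =>
        rw [map_sub, map_sub, lift_ctGen_of_zero, lift_ctGen_of_zero, lift_ctGen_of_zero, sub_zero, sub_zero]
        exact zero_mem _
      | succ n =>
        rw [map_sub, map_sub, lift_ctGen_of_succ, lift_ctGen_of_succ, lift_ctGen_of_succ]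
        refine hR (D n r - D n r₁ - D n r₂) (sub_mem (sub_mem (hD n r) (hD n r₁)) (hD n r₂))
          (G n r - G n r₁ - G n r₂) (y n r - y n r₁ - y n r₂) ?_ ?_
        · simpa using sub_mem (sub_mem (hGy n r) (hGy n r₁)) (hGy n r₂)
        · have h := add_mem (add_mem (sub_mem hcF (hF n r)) (hF n r₁)) (hF n r₂)
          convert h using 1
          abel
    · -- (1b) additivity in the integrand
      obtain ⟨m, r, r₁, r₂, -, -, -, rfl⟩ := hc
      cases m with
      | zero =>
        rw [map_sub, map_sub, lift_ctGen_of_zero, lift_ctGen_of_zero, lift_ctGen_of_zero, sub_zero, sub_zero]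
        exact zero_mem _
      | succ n =>
        rw [map_sub, map_sub, lift_ctGen_of_succ, lift_ctGen_of_succ, lift_ctGen_of_succ]
        refine hR (D n r - D n r₁ - D n r₂) (sub_mem (sub_mem (hD n r) (hD n r₁)) (hD n r₂))
          (G n r - G n r₁ - G n r₂) (y n r - y n r₁ - y n r₂) ?_ ?_
        · simpa using sub_mem (sub_mem (hGy n r) (hGy n r₁)) (hGy n r₂)
        · have h := add_mem (add_mem (sub_mem hcF (hF n r)) (hF n r₁)) (hF n r₂)
          convert h using 1
          abel
    · -- (2) fibred change of variables
      obtain ⟨n, r, r', Φ, Φ', -, -, -, -, -, -, rfl⟩ := hc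
      rw [map_sub, lift_ctGen_of_succ, lift_ctGen_of_succ]
      refine hR (D n r - D n r') (sub_mem (hD n r) (hD n r')) (G n r - G n r') (y n r - y n r') ?_ ?_
      · simpa using sub_mem (hGy n r) (hGy n r')
      · have h := add_mem (sub_mem hcF (hF n r)) (hF n r')
        convert h using 1
        abel
    · -- (3) fibred Newton–Leibniz along the last coordinate (base dimension ≥ 1)
      obtain ⟨-, n, r, r', rfl⟩ := hc
      rw [map_sub, lift_ctGen_of_succ, lift_ctGen_of_succ]
      refine hR (D (n + 1) r - D n r') (sub_mem (hD (n + 1) r) (hD n r')) (G (n + 1) r - G n r')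
        (y (n + 1) r - y n r') ?_ ?_
      · simpa using sub_mem (hGy (n + 1) r) (hGy n r')
      · have h := add_mem (sub_mem hcF (hF (n + 1) r)) (hF n r')
        convert h using 1
        abel
  · -- (CT3) a dominated family goes to its special fibre: compare the chosen normal form with the trivial one
    intro n R r₀ g hdom
    rw [lift_ctGen_of_succ]
    have hgen0 : (KZ.of R, KZ.of r₀) ∈ {v : Literature.NumberTheory.Transcendental.KZ.FormalRep × Literature.NumberTheory.Transcendental.KZ.FormalRep | ∃ (n : ℕ) (S : Literature.NumberTheory.Transcendental.KZ.IntegralRep (n + 1)) (r₀ g : Literature.NumberTheory.Transcendental.KZ.IntegralRep n), ((∃ ε > (0 : ℝ), ∀ z ∈ S.domain, 0 < z 0 → z 0 < ε → (fun i : Fin n => z i.succ) ∈ g.domain ∧ |S.integrand z| ≤ g.integrand (fun i : Fin n => z i.succ)) ∧ (∀ᵐ x : Fin n → ℝ, ∀ᶠ s in nhdsWithin (0 : ℝ) (Set.Ioi 0), (Matrix.vecCons s x ∈ S.domain ↔ x ∈ r₀.domain)) ∧ (∀ᵐ x : Fin n → ℝ, x ∈ r₀.domain → Filter.Tendsto (fun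 s : ℝ => S.integrand (Matrix.vecCons s x)) (nhdsWithin 0 (Set.Ioi 0)) (nhds (r₀.integrand x)))) ∧ v = (Literature.NumberTheory.Transcendental.KZ.of S, Literature.NumberTheory.Transcendental.KZ.of r₀)} := ⟨n, R, r₀, g, hdom, rfl⟩
    have hgen : (KZ.of R, KZ.of r₀) ∈ AddSubgroup.closure {v : Literature.NumberTheory.Transcendental.KZ.FormalRep × Literature.NumberTheory.Transcendental.KZ.FormalRep | ∃ (n : ℕ) (S : Literature.NumberTheory.Transcendental.KZ.IntegralRep (n + 1)) (r₀ g : Literature.NumberTheory.Transcendental.KZ.IntegralRep n), ((∃ ε > (0 : ℝ), ∀ z ∈ S.domain, 0 < z 0 → z 0 < ε → (fun i : Fin n => z i.succ) ∈ g.domain ∧ |S.integrand z| ≤ g.integrand (fun i : Fin n => z i.succ)) ∧ (∀ᵐ x : Fin n → ℝ, ∀ᶠ s in nhdsWithin (0 : ℝ) (Set.Ioi 0), (Matrix.vecCons s x ∈ S.domain ↔ x ∈ r₀.domain)) ∧ (∀ᵐ x : Fin n → ℝ, x ∈ r₀.domain → Filter.Tendsto (fun s : ℝ => S.integrand (Matrix.vecCons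 s x)) (nhdsWithin 0 (Set.Ioi 0)) (nhds (r₀.integrand x)))) ∧ v = (Literature.NumberTheory.Transcendental.KZ.of S, Literature.NumberTheory.Transcendental.KZ.of r₀)} :=
      AddSubgroup.subset_closure hgen0
    have key := hR (-(D n R)) (neg_mem (hD n R)) (KZ.of R - G n R) (KZ.of r₀ - y n R)
      (by simpa using sub_mem hgen (hGy n R)) (by convert hF n R using 1; abel)
    simpa using neg_mem key

/-- **Value shadow of special-fibre rigidity** (from the landed value realisation `stub_constantTermOfNormalForm'`
with `x = 0`, `c = 0`): if an elementary-divergent combination `D` plus a dominated combination `G` with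
special-fibre combination `y` is a fibred relation, then `eval y = 0`. [folklore] -/
theorem eval_eq_zero_of_add_mem_fibredRelations : ∀ D ∈ AddSubgroup.closure Summit.KontsevichZagierPeriods.ValuedFieldSpecialisation.elementaryGenerators, ∀ (G y : Literature.NumberTheory.Transcendental.KZ.FormalRep), (G, y) ∈ AddSubgroup.closure {v : Literature.NumberTheory.Transcendental.KZ.FormalRep × Literature.NumberTheory.Transcendental.KZ.FormalRep | ∃ (n : ℕ) (S : Literature.NumberTheory.Transcendental.KZ.IntegralRep (n + 1)) (r₀ g : Literature.NumberTheory.Transcendental.KZ.IntegralRep n), Literature.NumberTheory.Transcendental.KZ.IsDominatedFamily S r₀ g ∧ v = (Literature.NumberTheory.Transcendental.KZ.of S, Literature.NumberTheory.Transcendental.KZ.of r₀)} → D + G ∈ Literature.NumberTheory.Transcendental.KZ.fibredRelations → Literature.NumberTheory.Transcendental.KZ.eval y = 0 := by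
  intro D hD G y hGy hF
  refine stub_constantTermOfNormalForm' stub_elementarySliceValue stub_divergentMonomialsFilter 0 0 ?_ D hD G y hGy ?_
  · rw [map_zero]
    exact KZ.HasConstantTermAt.const 0
  · rw [zero_sub, ← neg_add', neg_mem_iff]
    exact hF

/-- Birth stub 3 of the line (constant term of a normal form, verbatim signature), from the landed general form
`stub_constantTermOfNormalForm'` with `x = of R`. [folklore] -/
theorem constantTermOfNormalForm : ∀ (n : ℕ) (R : Literature.NumberTheory.Transcendental.KZ.IntegralRep (n + 1)) (c : ℝ), (∃ (k : ℕ) (a : Fin k → ℚ) (b : Fin k → ℕ) (w : Fin k → ℝ), (∀ i, a i < 0 ∨ (a i = 0 ∧ 0 < b i)) ∧ Filter.Tendsto (fun s : ℝ => (∫ x in {x : Fin n → ℝ | Matrix.vecCons s x ∈ R.domain}, R.integrand (Matrix.vecCons s x)) - ∑ i, w i * s ^ ((a i : ℚ) : ℝ) * Real.log s ^ (b i)) (nhdsWithin 0 (Set.Ioi 0)) (nhds c)) → ∀ D ∈ AddSubgroup.closure {x : Literature.NumberTheory.Transcendental.KZ.FormalRep | ∃ (p q b d : ℕ) (r : Literature.NumberTheory.Transcendental.KZ.IntegralRep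 d) (P : Literature.NumberTheory.Transcendental.KZ.IntegralRep (b + d + 1 + 1)), 0 < q ∧ (0 < p ∨ 0 < b) ∧ P.domain = {z | ∃ (s u : ℝ) (y : Fin b → ℝ) (w : Fin d → ℝ), z = Matrix.vecCons s (Matrix.vecCons u (Fin.append y w)) ∧ 0 < s ∧ s < 1 ∧ 0 < u ∧ u ^ q * s ^ p < 1 ∧ (∀ j, s ≤ y j ∧ y j ≤ 1) ∧ w ∈ r.domain} ∧ P.integrand = (fun z => (∏ j : Fin b, (z (Fin.castAdd d j).succ.succ)⁻¹) * r.integrand (fun l : Fin d => z (Fin.natAdd b l).succ.succ)) ∧ x = Literature.NumberTheory.Transcendental.KZ.of P}, ∀ (G y : Literature.NumberTheory.Transcendental.KZ.FormalRep), (G, y) ∈ AddSubgroup.closure {v : Literature.NumberTheory.Transcendental.KZ.FormalRep × Literature.NumberTheory.Transcendental.KZ.FormalRep | ∃ (n : ℕ) (S : Literature.NumberTheory.Transcendental.KZ.IntegralRep (n + 1)) (r₀ g : Literature.NumberTheory.Transcendental.KZ.IntegralRep n), ((∃ ε > (0 : ℝ), ∀ z ∈ S.domain, 0 < z 0 → z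 0 < ε → (fun i : Fin n => z i.succ) ∈ g.domain ∧ |S.integrand z| ≤ g.integrand (fun i : Fin n => z i.succ)) ∧ (∀ᵐ x : Fin n → ℝ, ∀ᶠ s in nhdsWithin (0 : ℝ) (Set.Ioi 0), (Matrix.vecCons s x ∈ S.domain ↔ x ∈ r₀.domain)) ∧ (∀ᵐ x : Fin n → ℝ, x ∈ r₀.domain → Filter.Tendsto (fun s : ℝ => S.integrand (Matrix.vecCons s x)) (nhdsWithin 0 (Set.Ioi 0)) (nhds (r₀.integrand x)))) ∧ v = (Literature.NumberTheory.Transcendental.KZ.of S, Literature.NumberTheory.Transcendental.KZ.of r₀)} → Literature.NumberTheory.Transcendental.KZ.of R - D - G ∈ AddSubgroup.closure (Literature.NumberTheory.Transcendental.KZ.domainAddRel ∪ Literature.NumberTheory.Transcendental.KZ.integrandAddRel ∪ {c | ∃ (n : ℕ) (r r' : Literature.NumberTheory.Transcendental.KZ.IntegralRep (n + 1)) (Φ : (Fin (n + 1) → ℝ) → (Fin (n + 1) → ℝ)) (Φ' : (Fin (n + 1) → ℝ) → (Fin (n + 1) → ℝ) →L[ℝ] (Fin (n + 1) → ℝ)),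 Literature.NumberTheory.Transcendental.IsSemialgebraicMapOn ℚ r.domain Φ ∧ (∀ x ∈ r.domain, HasFDerivWithinAt Φ (Φ' x) r.domain x) ∧ Set.InjOn Φ r.domain ∧ r'.domain = Φ '' r.domain ∧ (∀ x ∈ r.domain, r.integrand x = r'.integrand (Φ x) * |(Φ' x).det|) ∧ (∀ x ∈ r.domain, Φ x 0 = x 0) ∧ c = Literature.NumberTheory.Transcendental.KZ.of r - Literature.NumberTheory.Transcendental.KZ.of r'} ∪ {c | c ∈ Literature.NumberTheory.Transcendental.KZ.newtonLeibnizRel ∧ ∃ (n : ℕ) (r : Literature.NumberTheory.Transcendental.KZ.IntegralRep (n + 2)) (r' : Literature.NumberTheory.Transcendental.KZ.IntegralRep (n + 1)), c = Literature.NumberTheory.Transcendental.KZ.of r - Literature.NumberTheory.Transcendental.KZ.of r'}) → Literature.NumberTheory.Transcendental.KZ.eval y = c := by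
  intro n R c hc D hD G y hGy hF
  refine stub_constantTermOfNormalForm' stub_elementarySliceValue stub_divergentMonomialsFilter (KZ.of R) c ?_
    D hD G y hGy hF
  rw [KZ.sliceEval_of]
  exact hc

/-- **The value-level constant-term functor exists given normal forms** (unconditional in the calculus):
`ClassLevelExpansion` implies `CTConstruction` with `KZ.relations` replaced by `ker KZ.eval` in (CT2) and (CT3) —
an additive `CT` whose values are the constant terms (CT1 verbatim), which kills fibred move generators and
specialises dominated families to their special fibres UP TO ELEMENTS OF VALUE ZERO. Composition with
`H = ker eval`, rigidity into `ker eval` being the value shadow. [folklore] -/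
theorem stub_ctConstruction_modKer_of_classLevelExpansion : Summit.KontsevichZagierPeriods.KontsevichZagierPeriods.Theses.ValuedFieldSpecialisation.ClassLevelExpansion → (∃ CT : Literature.NumberTheory.Transcendental.KZ.FormalRep →+ Literature.NumberTheory.Transcendental.KZ.FormalRep, (∀ (n : ℕ) (R : Literature.NumberTheory.Transcendental.KZ.IntegralRep (n + 1)) (c : ℝ), (∃ (k : ℕ) (a : Fin k → ℚ) (b : Fin k → ℕ) (w : Fin k → ℝ), (∀ i, a i < 0 ∨ (a i = 0 ∧ 0 < b i)) ∧ Filter.Tendsto (fun s : ℝ => (∫ x in {x : Fin n → ℝ | Matrix.vecCons s x ∈ R.domain}, R.integrand (Matrix.vecCons s x)) - ∑ i, w i * s ^ ((a i : ℚ) : ℝ) * Real.log s ^ (b i)) (nhdsWithin 0 (Set.Ioi 0)) (nhds c)) → Literature.NumberTheory.Transcendental.KZ.eval (CT (Literature.NumberTheory.Transcendental.KZ.of R)) = c) ∧ (∀ c ∈ (Literature.NumberTheory.Transcendental.KZ.domainAddRel ∪ Literature.NumberTheory.Transcendental.KZ.integrandAddRel ∪ {c | ∃ (n : ℕ) (r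 r' : Literature.NumberTheory.Transcendental.KZ.IntegralRep (n + 1)) (Φ : (Fin (n + 1) → ℝ) → (Fin (n + 1) → ℝ)) (Φ' : (Fin (n + 1) → ℝ) → (Fin (n + 1) → ℝ) →L[ℝ] (Fin (n + 1) → ℝ)), Literature.NumberTheory.Transcendental.IsSemialgebraicMapOn ℚ r.domain Φ ∧ (∀ x ∈ r.domain, HasFDerivWithinAt Φ (Φ' x) r.domain x) ∧ Set.InjOn Φ r.domain ∧ r'.domain = Φ '' r.domain ∧ (∀ x ∈ r.domain, r.integrand x = r'.integrand (Φ x) * |(Φ' x).det|) ∧ (∀ x ∈ r.domain, Φ x 0 = x 0) ∧ c = Literature.NumberTheory.Transcendental.KZ.of r - Literature.NumberTheory.Transcendental.KZ.of r'} ∪ {c | c ∈ Literature.NumberTheory.Transcendental.KZ.newtonLeibnizRel ∧ ∃ (n : ℕ) (r : Literature.NumberTheory.Transcendental.KZ.IntegralRep (n + 2)) (r' : Literature.NumberTheory.Transcendental.KZ.IntegralRep (n + 1)), c = Literature.NumberTheory.Transcendental.KZ.of r - Literature.NumberTheory.Transcendental.KZ.of r'}), CT c ∈ Literature.NumberTheory.Transcendental.KZ.eval.ker)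 ∧ (∀ (n : ℕ) (R : Literature.NumberTheory.Transcendental.KZ.IntegralRep (n + 1)) (r₀ g : Literature.NumberTheory.Transcendental.KZ.IntegralRep n), ((∃ ε > (0 : ℝ), ∀ z ∈ R.domain, 0 < z 0 → z 0 < ε → (fun i : Fin n => z i.succ) ∈ g.domain ∧ |R.integrand z| ≤ g.integrand (fun i : Fin n => z i.succ)) ∧ (∀ᵐ x : Fin n → ℝ, ∀ᶠ s in nhdsWithin (0 : ℝ) (Set.Ioi 0), (Matrix.vecCons s x ∈ R.domain ↔ x ∈ r₀.domain)) ∧ (∀ᵐ x : Fin n → ℝ, x ∈ r₀.domain → Filter.Tendsto (fun s : ℝ => R.integrand (Matrix.vecCons s x)) (nhdsWithin 0 (Set.Ioi 0)) (nhds (r₀.integrand x)))) → CT (Literature.NumberTheory.Transcendental.KZ.of R) - Literature.NumberTheory.Transcendental.KZ.of r₀ ∈ Literature.NumberTheory.Transcendental.KZ.eval.ker)) := by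
  intro h₁
  refine ctConstruction_of_normalForms_to Literature.NumberTheory.Transcendental.KZ.eval.ker h₁ ?_ constantTermOfNormalForm
  intro D hD G y hGy hF
  exact AddMonoidHom.mem_ker.mpr (eval_eq_zero_of_add_mem_fibredRelations D hD G y hGy hF)

/-- **`ClassLevelExpansion → KZKernelConjecture → CTConstruction`**: the crux of route ValuedFieldSpecialisation is
implied by its existence item (stmt-KontsevichZagierPeriods-3496) together with the Kontsevich–Zagier kernel
conjecture `ker eval = relations` (equivalent to the summit, `kzKernelConjecture_iff_isRational`): the kernel
conjecture upgrades the value shadow `eval y = 0` to the class-level rigidity `y ∈ relations`, which is all the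
composition needs. In particular an ambiguity witness against `CTConstruction` refutes `ClassLevelExpansion` or
exhibits an element of `ker eval ∖ relations`. [folklore] -/
theorem ctConstruction_of_classLevelExpansion_of_kzKernelConjecture (h₁ : ClassLevelExpansion)
    (hK : Literature.NumberTheory.Transcendental.KZKernelConjecture) : CTConstruction :=
  ctConstruction_of_normalForms_to Literature.NumberTheory.Transcendental.KZ.relations h₁
    (fun D hD G y hGy hF => hK y (eval_eq_zero_of_add_mem_fibredRelations D hD G y hGy hF))
    constantTermOfNormalForm

end Summit.KontsevichZagierPeriods.ValuedFieldSpecialisation
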